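import Literature.IUT.HodgeArakelov.ConstantMultipleRigidity
import HarnessLib

/-!
# [IUTchIII] Theorem 2.2 (ii) (b_v) at the REAL cohomology-module typing of [IUTchII] §1 (proof-only)

S. Mochizuki, *Inter-universal Teichmüller Theory III*, kurims manuscript (May 2020), Theorem 2.2 (ii)
"(Kummer Aspects of Multiradiality at Bad Primes)", pp. 65–66 [claim: Mochizuki2012, status: disputed]:
"(b_v) `Π_μ(M^Θ_*(†D_{>,v})) ⊗ ℚ/ℤ` [cf. the discussion of Proposition 2.1, (iii)], relative to the natural
isomorphism `Π_μ(M^Θ_*(†D_{>,v})) ⊗ ℚ/ℤ ⥲ _∞Ψ_{env}(†D_>)^μ_v` of [IUTchII], Remark 1.5.2 [cf. (a_v)]"; "each of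
the various composite maps `_∞Ψ_{env}(†D_>)^μ_v → Ψ^{ss}_{cns}(†F^⊢_△)^{×μ}_v` is equal to the zero map [cf. (b_v)]";
"the identity automorphism on [(a_v)–(d_v)] is compatible … with the collection of automorphisms of
`Ψ^{ss}_{cns}(†F^⊢_△)^{×μ}_v` induced by arbitrary automorphisms ∈ `Aut_{F^{⊢×μ}}(†F^{⊢×μ}_△)` [cf. [IUTchII],
Corollary 1.12, (iii); [IUTchII], Proposition 3.4, (i)]".

Companion of `ThetaMonoidsThm22Cor23Proofs.lean` (abc-iut cell, DISCHARGE-L6 §F row F13-b; sub-DAG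
`plan/L6/SUBDAG-IUTchIII-Thm-22.md` rows Thm-22.ii.r6 «[IUTchII] Cor 1.12 (iii)» and r13 «[IUTchII] Remark
1.5.2»): the same clauses at abc-iut-L6-t1's REAL typing of the mono-theta-theoretic cohomology modules
(`ThetaEnvData.cohEnv.lim` = `lim_J H¹(Π_Ÿ(M^Θ_*)|_J, Π_μ(M^Θ_*))`, `Rmk152_kummerTorsion` = the injection
`Π_μ(M^Θ_*) ⊗ ℚ/ℤ ↪ lim_J H¹` with image the torsion, `MuXmuDiagram` = the diagram `(†μ,×μ)` of Cor 1.12 (iii),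
`ConstantMultipleRigidity.lean` v2 p410537). PROVED, no new definitions:

* `thm22_ii_bv_iso` / `thm22_ii_bv_iso_unique` — the printed "natural isomorphism
  `Π_μ(M^Θ_*) ⊗ ℚ/ℤ ⥲ _∞Ψ^μ`": under `Rmk152_kummerTorsion T Q κ` the injection `κ` co-restricts to an additive
  ISOMORPHISM of `Q` onto the torsion subgroup of `lim_J H¹`, uniquely;
* `thm22_ii_bv_zeroMap` — for ANY additive homomorphism `f` from `lim_J H¹` to an `F^⊢`-side group `A` (the
  inverse Kummer isomorphism of Prop 2.1 (ii) followed by the maps of the diagram of Thm 2.2 (ii)), the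
  composite `Q → lim_J H¹ → A ↠ A/A^μ` is ZERO;
* `thm22_ii_bv_compatible` — hence compatible with EVERY endomorphism of `A/A^μ` (the automorphisms induced
  by `Aut_{F^{⊢×μ}}(†F^{⊢×μ}_△)` in particular): the square with the identity on `Q` commutes;
* `thm22_ii_bv_muXmu` — through abc-iut-L6-t1's `MuXmuDiagram` (Cor 1.12 (iii)): the composite
  `Q ⥲ M^μ_TM(M^Θ_*) ⊆ M^×_TM(M^Θ_*) ↠ M^{×μ}_TM(M^Θ_*)` is zero (the mono-theta-side copy of t1's
  `ThetaEvaluation.mmuTM_to_mxmuTM_eq_zero`).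

Honest framing: interface-level bookkeeping over t1's typed objects + Mathlib torsion/quotient API; the
printed objects are not constructed here; nothing asserts a disputed claim or takes a side on [IUTchIII]
Cor. 3.12; typed ≠ proved.
-/

namespace Literature.IUT.LogThetaLattice

open Literature.IUT.HodgeArakelov

universe u

variable {S : ThetaSetting.{u}} {F : ModelFamily S} {Sys : MonoThetaProjSystem F}

/-- **IUTchIII:Thm2.2(ii)** (kurims p.66) (b_v) "the natural isomorphism
`Π_μ(M^Θ_*(†D_{>,v})) ⊗ ℚ/ℤ ⥲ _∞Ψ_{env}(†D_>)^μ_v` of [IUTchII], Remark 1.5.2": under abc-iut-L6-t1's typing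
`Rmk152_kummerTorsion T Q κ` ("a natural … injection `Π_μ(M^Θ_*) ⊗ ℚ/ℤ ↪ lim_J H¹(…)` whose image is equal
to the torsion subgroup") the injection co-restricts to an additive ISOMORPHISM of `Q` onto the torsion
subgroup, agreeing with `κ`. [claim: Mochizuki2012, status: disputed] -/
theorem thm22_ii_bv_iso (T : ThetaEnvData Sys) {Q : Type u} [AddCommGroup Q] {κ : Q →+ T.cohEnv.lim}
    (h : Rmk152_kummerTorsion T Q κ) :
    ∃ e : Q ≃+ AddCommGroup.torsion T.cohEnv.lim,
      ∀ q, ((e q : AddCommGroup.torsion T.cohEnv.lim) : T.cohEnv.lim) = κ q := by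
  obtain ⟨hinj, hrange⟩ := h
  have hmem : ∀ q, κ q ∈ AddCommGroup.torsion T.cohEnv.lim := fun q => by
    rw [AddCommGroup.mem_torsion]
    have hq : κ q ∈ Set.range κ := ⟨q, rfl⟩
    rw [hrange] at hq
    exact hq
  refine ⟨AddEquiv.ofBijective (κ.codRestrict (AddCommGroup.torsion T.cohEnv.lim) hmem) ⟨?_, ?_⟩,
    fun q => rfl⟩
  · intro a b hab
    exact hinj (congrArg Subtype.val hab)
  · rintro ⟨x, hx⟩
    have hx' : x ∈ Set.range κ := by
      rw [hrange]
      exact (AddCommGroup.mem_torsion x).mp hx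
    obtain ⟨q, rfl⟩ := hx'
    exact ⟨q, rfl⟩

/-- **IUTchIII:Thm2.2(ii)** (kurims p.66) (b_v) uniqueness of that isomorphism: any two co-restrictions of
`κ` onto the torsion subgroup coincide ("natural"). [claim: Mochizuki2012, status: disputed] -/
theorem thm22_ii_bv_iso_unique (T : ThetaEnvData Sys) {Q : Type u} [AddCommGroup Q]
    {κ : Q →+ T.cohEnv.lim} (e e' : Q ≃+ AddCommGroup.torsion T.cohEnv.lim)
    (he : ∀ q, ((e q : AddCommGroup.torsion T.cohEnv.lim) : T.cohEnv.lim) = κ q)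
    (he' : ∀ q, ((e' q : AddCommGroup.torsion T.cohEnv.lim) : T.cohEnv.lim) = κ q) : e = e' := by
  ext q
  exact (he q).trans (he' q).symm

/-- **IUTchIII:Thm2.2(ii)** (kurims p.66) "each of the various composite maps
`_∞Ψ_{env}(†D_>)^μ_v → Ψ^{ss}_{cns}(†F^⊢_△)^{×μ}_v` is equal to the zero map [cf. (b_v)]" at t1's typing: for ANY
additive homomorphism `f` from `lim_J H¹(Π_Ÿ(M^Θ_*)|_J, Π_μ(M^Θ_*))` to an `F^⊢`-side group `A` (in print the
inverse of the second Kummer isomorphism of Prop 2.1 (ii) followed by the natural maps of the diagram), the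
composite `Π_μ ⊗ ℚ/ℤ →κ lim_J H¹ →f A ↠ A^{×μ} = A/A^μ` vanishes. [claim: Mochizuki2012, status: disputed] -/
theorem thm22_ii_bv_zeroMap (T : ThetaEnvData Sys) {Q : Type u} [AddCommGroup Q] {κ : Q →+ T.cohEnv.lim}
    (h : Rmk152_kummerTorsion T Q κ) {A : Type*} [AddCommGroup A] (f : T.cohEnv.lim →+ A) (q : Q) :
    (QuotientAddGroup.mk' (AddCommGroup.torsion A)) (f (κ q)) = 0 := by
  have hq : IsOfFinAddOrder (κ q) := by
    have hq' : κ q ∈ Set.range κ := ⟨q, rfl⟩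
    rw [h.2] at hq'
    exact hq'
  rw [QuotientAddGroup.mk'_apply, QuotientAddGroup.eq_zero_iff]
  exact f.isOfFinAddOrder hq

/-- **IUTchIII:Thm2.2(ii)** (kurims p.66) "the identity automorphism on [(b_v)] is compatible, relative to
the various natural morphisms involved, with the collection of automorphisms of `Ψ^{ss}_{cns}(†F^⊢_△)^{×μ}_v`
induced by arbitrary automorphisms ∈ `Aut_{F^{⊢×μ}}(†F^{⊢×μ}_△)`" at t1's typing: the square `(id_Q, β)` over the
composite of `thm22_ii_bv_zeroMap` commutes for EVERY endomorphism `β` of `A/A^μ`.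
[claim: Mochizuki2012, status: disputed] -/
theorem thm22_ii_bv_compatible (T : ThetaEnvData Sys) {Q : Type u} [AddCommGroup Q]
    {κ : Q →+ T.cohEnv.lim} (h : Rmk152_kummerTorsion T Q κ) {A : Type*} [AddCommGroup A]
    (f : T.cohEnv.lim →+ A) (β : A ⧸ AddCommGroup.torsion A →+ A ⧸ AddCommGroup.torsion A) (q : Q) :
    β ((QuotientAddGroup.mk' (AddCommGroup.torsion A)) (f (κ q))) =
      (QuotientAddGroup.mk' (AddCommGroup.torsion A)) (f (κ (id q))) := by
  rw [thm22_ii_bv_zeroMap T h f q, map_zero, id, thm22_ii_bv_zeroMap T h f q]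

/-- **IUTchIII:Thm2.2(ii)** (kurims p.66) "[cf. [IUTchII], Corollary 1.12, (iii)]": through abc-iut-L6-t1's
diagram `(†μ,×μ)` (`MuXmuDiagram`, Cor 1.12 (iii) p.58: `Π_μ(M^Θ_*) ⊗ ℚ/ℤ ⥲ M^μ_TM(M^Θ_*) ⥲ M^μ_TM(Π) → M^{×μ}_TM(Π)`
"the `→` is the trivial homomorphism") the mono-theta-side composite
`Π_μ ⊗ ℚ/ℤ ⥲ M^μ_TM(M^Θ_*) ⊆ M^×_TM(M^Θ_*) ↠ M^×_TM(M^Θ_*)/M^μ_TM(M^Θ_*)` is ZERO — the `M^Θ_*`-side copy of t1's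
`ThetaEvaluation.mmuTM_to_mxmuTM_eq_zero`. [claim: Mochizuki2012, status: disputed] -/
theorem thm22_ii_bv_muXmu {T : ThetaEnvData Sys} {E : EnvOfGroup S Sys.PiX} {I : PointedInversion E T.D}
    (Ev : ThetaEvaluation T E I) {A : AbsTopMonoids S} {G : IsoClass S.Gk} {Q : Type u} [AddCommGroup Q]
    {κ : Q →+ T.cohEnv.lim} (Δ : MuXmuDiagram Ev A G Q κ) (q : Q) :
    (QuotientAddGroup.mk ((Δ.e₁₂ q : Ev.MmuTMEnv) : Ev.MxTMEnv) :
      Ev.MxTMEnv ⧸ AddCommGroup.torsion Ev.MxTMEnv) = 0 := by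
  rw [QuotientAddGroup.eq_zero_iff]
  exact (Δ.e₁₂ q).2

/-- **IUTchIII:Thm2.2(ii)** (kurims p.66) (b_v) pinned to the Rmk 1.5.2 injection: inside `lim_J H¹` the
element `Δ.e₁₂ q` of `M^μ_TM(M^Θ_*)` IS `κ q` (t1's `MuXmuDiagram.e₁₂_compat`), so the zero map above is the one
"relative to the natural isomorphism … of [IUTchII], Remark 1.5.2". [claim: Mochizuki2012, status: disputed] -/
theorem thm22_ii_bv_muXmu_compat {T : ThetaEnvData Sys} {E : EnvOfGroup S Sys.PiX}
    {I : PointedInversion E T.D} (Ev : ThetaEvaluation T E I) {A : AbsTopMonoids S} {G : IsoClass S.Gk}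
    {Q : Type u} [AddCommGroup Q] {κ : Q →+ T.cohEnv.lim} (Δ : MuXmuDiagram Ev A G Q κ) (q : Q) :
    (((Δ.e₁₂ q : Ev.MmuTMEnv) : Ev.MxTMEnv) : T.cohEnv.lim) = κ q :=
  Δ.e₁₂_compat q

end Literature.IUT.LogThetaLattice
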